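import Literature.MathematicalPhysics.QuantumFieldTheory.Balaban1983to89.B8LeafModelZd3

/-!
# `Balaban1983to89.B8LeafSocketsB9` — [Balaban1985RegularSpaces] THE IN-EDGE b9 ([4] Theorem 3.3 read through (1.57)–(1.59)) AS ONE SOCKET:
# `SockB9P3` AT EVERY TRUNCATION LEVEL serves BOTH the Theorem-4 frame (`B8LeafModelZd.SockH59`) and the Proposition-3 frame (`SockB9P3`)

statement-level skeleton of published theorems with citation tags; proofs where landed; nothing here is a claim about the
Yang–Mills mass gap

PDF held: `paper:balaban1985-cmp99-regular-spaces-gauge-fixing` (journal page = PDF page + 74); pp. 86–88 ((1.57)–(1.62), Thm 4's induction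
«the same conditions for k − 1»).

WHY THIS FILE (cell `pub-ymgap`, seat `pub-ymgap-dag-n05-a` g5; count-neutral).  The knit `B8LeafKnitZd3.b8LeafRS_zd3_univ` carries TWO b9
sockets per member: `SockH59` (g4; Theorem 4's induction needs the two (1.59) lines at EVERY truncation level `m ≤ k`, for the gauge-fixed datum
`(u, W = U′^{u⁻¹}, A′)` at the smallness constant `2Lc⋆ + 8α₄`) and `SockB9P3` (g5; Proposition 3 needs all five lines at the top level `k` for
any Landau-gauge `W` with a masked Hermitian exponent of size `α₂`).  They are not inter-derivable as stated (design note §5), but BOTH follow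
from `SockB9P3` ASSERTED AT EVERY TRUNCATION LEVEL `m ≤ k` (with the truncated constraint data `Λs m`, `Λb m` — print p. 88 «the same
conditions for k − 1») — which is the natural output of a b9 provider proving [4] Theorem 3.3 level by level.  So the provider (N06 junction)
has ONE target per member: `∀ m ≤ k, SockB9P3 L B₀ B₀β cP β len η m Ω Λs Λb`.

WHAT IS PROVED (kernel, 0 sorry, theorems only, no definition): `sockB9P3_of_allLevels` (m := k), **`sockH59_of_allLevels`** (Theorem 4's
socket below the threshold `min cP (cP / K₀)`, `K₀ = 10dL²B₀ + 320dLB₀B₀′` the coefficient of `2Lc⋆ + 8α₄`: the datum `W = U′^{u⁻¹}` is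
unitary-valued and `WU₀ = (U′U₀)^{u⁻¹} ∈ 𝔄_m` by gauge invariance, `InAk` restricts from `k` to `m` levels).

HONEST SCOPE.  Socket bookkeeping; nothing of [4] is proved.  Count-neutral; N05 NOT discharged; nothing continuum / ℝ⁴ / OS / mass-gap / Clay.
Unit `pub-ymgap-dag-n05-a` (g5), 2026-08-26.
-/

noncomputable section

open NormedSpace

namespace Literature.MathematicalPhysics.QuantumFieldTheory.Balaban1983to89.B8LeafSocketsB9

open MatrixLog B7Prop1Explicit B7Prop2Explicit B7Prop1Local B7Eq92Concrete
open B8Ineq132 (covDerivFwd InAk)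
open B8Eq119TwistedAxial (Restr129 InAx)
open B8Eq184Proof (cfgExp)
open B8Lemma1NonAbelian (mulCfg)
open B8Eq140Level (SideTouches)
open B8Eq138LandauZd (IsLandau138W)
open B8Prop3GaugeFixedKLevel (mem_unitaryUnits_of_mgauge_eq mulCfg_eq_gaugeAct_of_mgauge_eq)
open B8LeafModelZd (SockH59)
open B8LeafModelZd3 (SockB9P3)

-- `Site` alone could resolve to the torus sites of `Setup.lean`; re-export the `ℤ^d` sites of `B7Prop1Explicit`.
export B7Prop1Explicit (Site)

variable {d : ℕ} {𝔸 : Type*} [CStarAlgebra 𝔸] [Nontrivial 𝔸]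

omit [Nontrivial 𝔸] in
/-- The top level `m = k` of the all-levels b9 socket is the Proposition-3 socket. [cite: Balaban1985RegularSpaces, (1.59) p.86] -/
theorem sockB9P3_of_allLevels {L : ℕ} {B₀ B₀β cP β : ℝ} {len : Site d → ℝ} {η : ℝ} {k : ℕ} {Ω : ℕ → Set (Site d)}
    {Λs : ℕ → ℕ → Set (Site d)} {Λb : ℕ → ℕ → Set (Site d × Fin d)}
    (H : ∀ m, m ≤ k → SockB9P3 (𝔸 := 𝔸) L B₀ B₀β cP β len η m Ω Λs Λb) : SockB9P3 (𝔸 := 𝔸) L B₀ B₀β cP β len η k Ω Λs Λb :=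
  H k le_rfl

/-- **THEOREM 4's b9 SOCKET `SockH59` FROM THE ALL-LEVELS b9 SOCKET**: below `min cP (cP / K₀)`, `K₀ = 2L·5dLB₀ + 8·8B₀′·5dLB₀` (so that
Theorem 4's smallness constant `2Lc⋆ + 8α₄ = K₀(α₀ + α₁) ≤ cP` and `α₀ ≤ cP`), the datum `(u, W, A′)` of the induction at level `m` — `u`
unitary-valued, `W^{u} = U′`, the Landau condition of record at `m` levels, `A′` masked Hermitian with `W = e^{iηA′}` and `‖A′‖ ≤ (2Lc⋆ + 8α₄)(Lʲη)⁻¹`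
on the `E j`, `j ≤ m` — is a datum of `SockB9P3` at level `m` (`W` unitary-valued by `mem_unitaryUnits_of_mgauge_eq`; `WU₀ = (U′U₀)^{u⁻¹} ∈ 𝔄`
by `mulCfg_eq_gaugeAct_of_mgauge_eq` + `inAk_gaugeAct_iff`; `U₀ ∈ 𝔄_m` by restriction of levels), and its first two (1.59) lines are the
conclusion. [cite: Balaban1985RegularSpaces, (1.59) p.86, Thm 4 p.88 («the same conditions for k − 1»), (1.69) p.88] -/
theorem sockH59_of_allLevels (hd : 1 ≤ d) {L : ℕ} (hL : 1 ≤ L) {B₀ B₀' B₀β cP β : ℝ} (hB₀ : 0 < B₀) (hB₀' : 0 ≤ B₀') (hcP : 0 < cP)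
    {len : Site d → ℝ} {η : ℝ} {k : ℕ} {Ω : ℕ → Set (Site d)} {Λs : ℕ → ℕ → Set (Site d)} {Λb : ℕ → ℕ → Set (Site d × Fin d)}
    (H : ∀ m, m ≤ k → SockB9P3 (𝔸 := 𝔸) L B₀ B₀β cP β len η m Ω Λs Λb) :
    SockH59 (𝔸 := 𝔸) L B₀ B₀' (min cP (cP / (2 * (L * (5 * (d : ℝ) * L * B₀)) + 8 * (8 * B₀' * (5 * (d : ℝ) * L * B₀)))))
      η k Ω Λs Λb := by
  set K₀ : ℝ := 2 * (L * (5 * (d : ℝ) * L * B₀)) + 8 * (8 * B₀' * (5 * (d : ℝ) * L * B₀)) with hK₀_def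
  have hL' : (1 : ℝ) ≤ L := by exact_mod_cast hL
  have hd' : (1 : ℝ) ≤ d := by exact_mod_cast hd
  have hK₀ : 0 < K₀ := by
    have h1 : 0 < 2 * (L * (5 * (d : ℝ) * L * B₀)) := by positivity
    have h2 : 0 ≤ 8 * (8 * B₀' * (5 * (d : ℝ) * L * B₀)) := by positivity
    linarith
  have hK₀ne : K₀ ≠ 0 := hK₀.ne'
  intro α₀ α₁ hα₀ hα₁ hs U₀ U' hU₀ hU' h33 h34 _ _ _ m _ hmk u W A' hu hW _ hLan hsa hWA hA0
  -- the smallness constant of the datum and the guard of the level-`m` socket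
  set K : ℝ := 2 * (L * (5 * (d : ℝ) * L * B₀ * (α₀ + α₁))) + 8 * (8 * B₀' * (5 * (d : ℝ) * L * B₀) * (α₀ + α₁)) with hK_def
  have hKK₀ : K = K₀ * (α₀ + α₁) := by rw [hK_def, hK₀_def]; ring
  have hS0 : 0 < α₀ + α₁ := add_pos hα₀ hα₁
  have hKpos : 0 < K := by rw [hKK₀]; exact mul_pos hK₀ hS0
  have hα₀P : α₀ ≤ cP := by linarith only [hα₁, hs, min_le_left cP (cP / K₀)]
  have hKP : K ≤ cP := by
    have h1 : α₀ + α₁ ≤ cP / K₀ := hs.trans (min_le_right _ _)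
    calc K = K₀ * (α₀ + α₁) := hKK₀
      _ ≤ K₀ * (cP / K₀) := mul_le_mul_of_nonneg_left h1 hK₀.le
      _ = cP := by field_simp
  -- the datum is a datum of `SockB9P3` at level `m`
  have hWu : ∀ x κ, W x κ ∈ unitaryUnits 𝔸 := mem_unitaryUnits_of_mgauge_eq hU₀ hU' hu hW
  have h33m : InAk L m η α₀ Ω U₀ := fun j hj => h33 j (hj.trans hmk)
  have h34m : InAk L m η α₀ Ω (mulCfg W U₀) := by
    have h1 : InAk L m η α₀ Ω (mulCfg U' U₀) := fun j hj => h34 j (hj.trans hmk)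
    have hui : ∀ x, u⁻¹ x ∈ U1 𝔸 := fun x => unitaryUnits_le_U1 ((unitaryUnits 𝔸).inv_mem (hu x))
    rw [mulCfg_eq_gaugeAct_of_mgauge_eq hW]
    exact (B8Ineq132.inAk_gaugeAct_iff L m η α₀ Ω hui _).2 h1
  obtain ⟨ha, hg, -, -, -⟩ := H m hmk α₀ K hα₀ hα₀P hKpos hKP U₀ W hU₀ hWu h33m h34m hLan A' hsa hWA hA0
  exact ⟨ha, hg⟩

#print axioms sockH59_of_allLevels

/-! ## §3 (v1.1) Monotonicity of the b9 socket in its constants `B₀`, `B₀β` — the unpacking glue for the N06 supply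

The N06 supplier (`pub-ymgap-dag-n06-b` `B9SupplySockB9P3Zd.sockB9P3_allLevels_of_thm33`) delivers the all-levels socket ∃-packaged:
`∃ B₀ B₀β cP, 0 < B₀ ∧ 0 ≤ B₀β ∧ 0 < cP ∧ ∀ i, ∀ m ≤ i.k, SockB9P3 L B₀ B₀β cP β len i.η m i.Ω i.Λs i.Λb`, while the knit
(`B8LeafKnitZd3B9All.b8LeafRS_zd3_univ_b9all`) reads `inp.B₀` with `2 ≤ 5dL·inp.B₀` (Theorem 4's `B₁′ = 5dLB₀`) and `0 < B₀β`: the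
consumer ENLARGES the supplier's constants (`B₀ ↦ max B₀ (2/(5dL))`, `B₀β ↦ B₀β + 1`), which the socket allows because its five (1.59)
lines are upper bounds `≤ B·(|J|₍₋₃₎ + |B₁|)` with a non-negative bracket. -/

omit [Nontrivial 𝔸] in
/-- **`SockB9P3` is MONOTONE in `B₀` and `B₀β`**: larger constants give weaker (1.59) lines (the bracket `|J|₍₋₃₎ + |B₁|` is `≥ 0`:
`msup_nonneg`, `wsup_nonneg`). [cite: Balaban1985RegularSpaces, (1.59) p.86] -/
theorem sockB9P3_mono {L : ℕ} {B₀ B₀' B₀β B₀β' cP β : ℝ} (hB : B₀ ≤ B₀') (hBβ : B₀β ≤ B₀β') {len : Site d → ℝ} {η : ℝ} (hη : 0 ≤ η)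
    {k : ℕ} {Ω : ℕ → Set (Site d)} {Λs : ℕ → ℕ → Set (Site d)} {Λb : ℕ → ℕ → Set (Site d × Fin d)}
    (S : SockB9P3 (𝔸 := 𝔸) L B₀ B₀β cP β len η k Ω Λs Λb) : SockB9P3 (𝔸 := 𝔸) L B₀' B₀β' cP β len η k Ω Λs Λb := by
  intro α₀ α₂ hα₀ hα₀c hα₂ hα₂c U₀ W hU₀ hW h33 h34 hLan A' hsa hWA hA0
  obtain ⟨ha, hg, hj, hl, hh⟩ := S α₀ α₂ hα₀ hα₀c hα₂ hα₂c U₀ W hU₀ hW h33 h34 hLan A' hsa hWA hA0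
  -- the bracket `|J|₍₋₃₎ + |B₁|` is non-negative
  have hbr : 0 ≤ B8ScaledSupNorm.bondNorm L k η (-(3 : ℝ)) Ω (fun x μ => B8Eq155JBound.Jcur η U₀ A' μ x)
      + B8Eq155JBound.wsup 1 (fun p : {p : ℕ × (Site d × Fin d) // p.1 ≤ k ∧ p.2 ∈ Λb k p.1} =>
          B7Prop4GeneralLevels.linCovIter L U₀ (B8Eq146AExpansion.iEta η A') p.1.1 p.1.2.1 p.1.2.2) := by
    refine add_nonneg ?_ (B8Eq155JBound.wsup_nonneg zero_le_one _)
    unfold B8ScaledSupNorm.bondNorm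
    exact B8ScaledSupNorm.msup_nonneg L k hη _ _ _
  have hB' := mul_le_mul_of_nonneg_right hB hbr
  have hBβ' := mul_le_mul_of_nonneg_right hBβ hbr
  exact ⟨ha.trans hB', hg.trans hB', hj.trans hB', hl.trans hB', hh.trans hBβ'⟩

omit [Nontrivial 𝔸] in
/-- **Unpacking the N06 supply for the knit**: from the supplier's ∃-package (`0 < B₀`, `0 ≤ B₀β`, `0 < cP`, the all-levels socket at every
member) to the knit's constants — SOME `B₀ > 0` with `2 ≤ 5dL·B₀`, SOME `B₀β > 0`, the socket at every member and every level `m ≤ i.k`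
(`d, L ≥ 1`). [cite: Balaban1985RegularSpaces, (1.59) p.86, Thm 4 p.88 (B₁′ = 5dLB₀)] -/
theorem sockB9P3_allLevels_unpack (hd : 1 ≤ d) {L : ℕ} (hL : 1 ≤ L) {β : ℝ} {len : Site d → ℝ}
    {ι : Type*} (η : ι → ℝ) (hη : ∀ i, 0 < η i) (k : ι → ℕ) (Ω : ι → ℕ → Set (Site d)) (Λs : ι → ℕ → ℕ → Set (Site d))
    (Λb : ι → ℕ → ℕ → Set (Site d × Fin d))
    (H : ∃ B₀ B₀β cP : ℝ, 0 < B₀ ∧ 0 ≤ B₀β ∧ 0 < cP ∧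
      ∀ i, ∀ m, m ≤ k i → SockB9P3 (𝔸 := 𝔸) L B₀ B₀β cP β len (η i) m (Ω i) (Λs i) (Λb i)) :
    ∃ B₀ B₀β cP : ℝ, 0 < B₀ ∧ 2 ≤ 5 * (d : ℝ) * L * B₀ ∧ 0 < B₀β ∧ 0 < cP ∧
      ∀ i, ∀ m, m ≤ k i → SockB9P3 (𝔸 := 𝔸) L B₀ B₀β cP β len (η i) m (Ω i) (Λs i) (Λb i) := by
  obtain ⟨B₀, B₀β, cP, hB₀, hB₀β, hcP, H⟩ := H
  have hd' : (1 : ℝ) ≤ d := by exact_mod_cast hd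
  have hL' : (1 : ℝ) ≤ L := by exact_mod_cast hL
  have hdL : 0 < 5 * (d : ℝ) * L := by positivity
  refine ⟨max B₀ (2 / (5 * (d : ℝ) * L)), B₀β + 1, cP, lt_max_of_lt_left hB₀, ?_, by linarith, hcP,
    fun i m hm => sockB9P3_mono (le_max_left _ _) (le_add_of_nonneg_right zero_le_one) (hη i).le (H i m hm)⟩
  calc (2 : ℝ) = 5 * (d : ℝ) * L * (2 / (5 * (d : ℝ) * L)) := by field_simp
    _ ≤ 5 * (d : ℝ) * L * max B₀ (2 / (5 * (d : ℝ) * L)) := mul_le_mul_of_nonneg_left (le_max_right _ _) hdL.le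

#print axioms sockB9P3_allLevels_unpack

end Literature.MathematicalPhysics.QuantumFieldTheory.Balaban1983to89.B8LeafSocketsB9

end
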